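import Summits.HodgeConjecture.HodgeConjecture.Theorems.F0P6aTwistDataCoprime                  -- ★ `exists_isArtinCorrespondent_splitPrime_congr`, `splitPrime_typeProd_twistRows` (LA7-p02 (g3))
import Summits.HodgeConjecture.HodgeConjecture.Theorems.F0P6aCanonicalTwistIdealAsReflexTypeNorm  -- ★ `idealReflexTypeNorm_eq_prod_filter_smul` (LA4-p04 (g2))
import Literature.AlgebraicGeometry.ShimuraVarieties.UnitaryAuxiliaryReflexConormTypeNormIdeal     -- ★ (B0) `il(g(con s))` read on `F` (+ ★ conorm transport)
import Literature.AlgebraicGeometry.ShimuraVarieties.UnitaryArtinCorrespondentInverse              -- ★ `IsArtinCorrespondent.inv'`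
import Literature.NumberTheory.ComplexMultiplication.ReflexNormIdelesCongruenceAtPrimes            -- ★ `reflexNormFiniteIdele_congr_at_primes_natCast_inv`
import Literature.FieldTheory.AlgClosed.AutomorphismExtension                                      -- ★ `exists_ringEquiv_apply_eq` (lifting `γ` to `Aut(ℂ)`)
import HarnessLib

/-!
# Crux `HLiu418` — sub-line F0-P6a, (S8) `stub_ESHEET`, organ (S6) «TWIST DATA»: THE GENERIC SHEET TWIST OF `γ ∈ Gal(Fᵢ∕F)` (junction leg `hgen`)

Cell `hodgecm-mathlib` (D-0151), crux `stmt-HodgeConjecture-24832` (hLiu418), `--supports` (count-neutral).  «L4» LA4-plan (g2) DEAL #30 (`stub_TWIST`) →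
LA4-p05 (g4): the GENERIC LEG `hgen` of the one-call zip ★ `F0P6aTwistDataOfKottRows.exists_twistData_letterRows_of_kottRows` at the admissibility
`Adm := IsSheetTwistOf ι₁ τE Φ hΦ N` of the (S8) closer skeleton v2 (`F0/P6/L4/LA4-plan/g2/StubESHEET.closer.skeleton.v2.LA4-plan-g2.lean` 934d75ea, junction
:163–:178, orientation `z = t(sE)` of 2026-09-02T07:23Z): for EVERY `γ` a datum `(𝔞, n)` with rows (a)(b)(c)(d) AND the junction witnesses — a lift `γ′ ∈ Aut(ℂ)` of
`γ` through `τE` fixing `ι₁F`, an EXACT `E♯`-correspondent `sE ↔ γ′` (`E♯ = Aux.reflexField F Φ′ ι₁`, `Φ′` any CM type — the closer takes `Φ′ := twistType ι₁ Φ hΦ`),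
whose reflex norm `z = g_{Φ′}(sE)` has ideal `𝔞⁻¹` and is `≡ 1 mod (N)` at the primes of `(N)` (valuation form).  THEOREMS ONLY; no `Cruxes/…/Lines` import
(the conclusion is the junction UNFOLDED, so the closer closes `hgen` by `exact ⟨𝔞, n, ⟨ha, hb, hc, γ′, sE, _, hlift, hfix, hsE, rfl, hz, hcong⟩, ha, hb, hc, hd⟩`).

ROAD ([Shimura1998] §18.6 proof pp. 127–129; [MilneCM2006] Ch. I Prop. 1.26; organ hands LA7-p02 (g3) (S6), LA4-p04 (g2) §1 of (S7), LA4-p05 (g4) glue):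
lift `γ′` (★ `AlgClosed.exists_ringEquiv_apply_eq` at `τE`, `τE ∘ γ`); an `F`-idèle `s ↔ γ′⁻¹` over `(F, ι₁)` whose ideal is a TOTALLY SPLIT degree-one prime `𝔮 ∤ (N)`
and which is `≡ 1 mod (N)` (★ `F0P6aTwistDataCoprime.exists_isArtinCorrespondent_splitPrime_congr`); its conorm `u := con_{E♯/F} s ↔ γ′⁻¹` over `E♯` (★
`isArtinCorrespondent_finiteIdeleConorm_of_hasSmallReflex`, `E♯ = ι₁F` for `F ∕ ℚ` Galois), `sE := u⁻¹ ↔ γ′` (★ `IsArtinCorrespondent.inv'`); `z := g_{Φ′}(sE) = g_{Φ′}(u)⁻¹`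
with `il(g(u)) = g_F(𝔮) = ∏_{g ∈ Φ*} g • 𝔮 =: 𝔞` (★ (B0) `toFractionalIdeal_reflexNormFiniteIdele_finiteIdeleConorm_of_eq_coeIdeal` + ★ `idealReflexTypeNorm_eq_prod_filter_smul`,
`Φ* = {g ∈ Gal(F∕ℚ) | ι₁ ∘ g⁻¹ ∈ Φ′}` a CM type read in the group), rows (a)(b)(c)(d) of `𝔞` with `n := N𝔮` (★ `splitPrime_typeProd_twistRows`), and the congruence
of `z` from that of `s` through `con` (★ `finiteIdeleConorm_congr_at_primes_natCast`) and `g` (★ `reflexNormFiniteIdele_congr_at_primes_natCast_inv`).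
HONEST LABEL.  HC_CM is proved only modulo the 7 printed citations (2 remaining named inputs: hLiu418 = stmt-HodgeConjecture-24832, h413 = stmt-HodgeConjecture-24833)
until rung 0 closes; nothing here changes a count.
[cite: Shimura1998, §18.6 proof pp. 127–129; §13.1 Thm. 1 (1), (7) pp. 97–99] [cite: MilneCM2006, Ch. I §1 Rem. 1.25, Prop. 1.26 (11)]
[cite: Milne2005ShimuraVarieties, (59) p. 107; Def. 12.8 (62) p. 114] [cite: RapoportSmithlingZhang2020Diagonal, §4.3 (4.23) p. 21]
-/

set_option autoImplicit false
set_option linter.dupNamespace false  -- `Summit.HodgeConjecture.HodgeConjecture.…` BY DESIGN (D-0017)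

noncomputable section

open NumberField IsDedekindDomain WithZero
open scoped Pointwise nonZeroDivisors Cardinal
open Literature.NumberTheory.GaloisRepresentations (modulusExp)
open Literature.NumberTheory.NumberFields (IdeleIdeal.coe_toIdealUnits)
open Literature.AlgebraicGeometry.Motives (CMType)
open Literature.AlgebraicGeometry.ShimuraVarieties (UnitaryCanonicalModel.IsArtinCorrespondent)
open Literature.AlgebraicGeometry.ShimuraVarieties.UnitaryCanonicalModel
open Literature.AlgebraicGeometry.ShimuraVarieties.UnitaryCanonicalModel.Aux
open Literature.NumberTheory.ComplexMultiplication
open Literature.NumberTheory.AdelicBaseChange (finiteIdeleConorm finiteIdeleConorm_congr_at_primes_natCast toFractionalIdeal_finiteIdeleConorm)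
open Literature.NumberTheory.Automorphic.FiniteAdeleRing (toFractionalIdeal)
open Summit.HodgeConjecture.HodgeConjecture.Theorems.F0P6aTwistDataCoprime (exists_isArtinCorrespondent_splitPrime_congr splitPrime_typeProd_twistRows)
open Summit.HodgeConjecture.HodgeConjecture.Theorems.F0P6aCanonicalTwistIdealAsReflexTypeNorm (idealReflexTypeNorm_eq_prod_filter_smul)

namespace Summit.HodgeConjecture.HodgeConjecture.Theorems.F0P6aSheetTwistGeneric

variable {F : Type} [Field F] [NumberField F] [IsCMField F]

/-! ### §1 The CM type `Φ′` read in `Gal(F∕ℚ)` -/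

/-- **The reflex type of `Φ′` read in `Gal(F∕ℚ)` is a CM type in the group**: `Φ* := {g | ι₁ ∘ g⁻¹ ∈ Φ′}` satisfies `g ∈ Φ* ↔ c̄·g ∉ Φ*`, because
`ι₁ ∘ (c̄ g)⁻¹ = ι₁ ∘ g⁻¹ ∘ c` is the complex conjugate of `ι₁ ∘ g⁻¹` (`φ ∘ c = φ̄` for every complex embedding of a CM field, Mathlib
`IsCMField.complexEmbedding_complexConj`) and `Φ′` contains exactly one of `φ, φ̄`. [cite: Shimura1998, §8.3 Prop. 29, p. 63] [cite: MilneCM2006, Ch. I §1 (CM types)] -/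
theorem mem_filter_iff_conj_mul_not_mem [DecidableEq (F ≃ₐ[ℚ] F)] (ι₁ : F →+* ℂ) (Φ' : CMType F)
    [DecidablePred (· ∈ valuedIn ι₁ Φ'.1)] (g : F ≃ₐ[ℚ] F) :
    g ∈ Finset.univ.filter (fun g : F ≃ₐ[ℚ] F => (RingHom.id F).comp ((g⁻¹ : F ≃ₐ[ℚ] F) : F →+* F) ∈ valuedIn ι₁ Φ'.1) ↔
      ((IsCMField.complexConj F).restrictScalars ℚ) * g ∉
        Finset.univ.filter (fun g : F ≃ₐ[ℚ] F => (RingHom.id F).comp ((g⁻¹ : F ≃ₐ[ℚ] F) : F →+* F) ∈ valuedIn ι₁ Φ'.1) := by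
  simp only [Finset.mem_filter, Finset.mem_univ, true_and, mem_valuedIn_iff, RingHom.id_comp]
  -- `ι₁ ∘ (c̄ g)⁻¹ = conjugate (ι₁ ∘ g⁻¹)`
  have hconj : ι₁.comp ((((IsCMField.complexConj F).restrictScalars ℚ * g)⁻¹ : F ≃ₐ[ℚ] F) : F →+* F) =
      ComplexEmbedding.conjugate (ι₁.comp ((g⁻¹ : F ≃ₐ[ℚ] F) : F →+* F)) := by
    refine RingHom.ext fun x => ?_
    rw [ComplexEmbedding.conjugate_coe_eq, RingHom.comp_apply, RingHom.comp_apply, mul_inv_rev]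
    change ι₁ (g⁻¹ ((((IsCMField.complexConj F).restrictScalars ℚ)⁻¹ : F ≃ₐ[ℚ] F) x)) = _
    have hc : (((IsCMField.complexConj F).restrictScalars ℚ)⁻¹ : F ≃ₐ[ℚ] F) x = IsCMField.complexConj F x := by
      have hinv : ((IsCMField.complexConj F).restrictScalars ℚ)⁻¹ = (IsCMField.complexConj F).restrictScalars ℚ := by
        refine inv_eq_of_mul_eq_one_right (AlgEquiv.ext fun y => ?_)
        change IsCMField.complexConj F (IsCMField.complexConj F y) = y
        exact IsCMField.complexConj_apply_apply F y
      rw [hinv]; rfl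
    rw [hc]
    -- `g⁻¹` commutes with `c` (a CM field: every embedding intertwines `c` with complex conjugation, and `ι₁ ∘ g⁻¹` is injective)
    have key : ι₁ ((g⁻¹ : F ≃ₐ[ℚ] F) (IsCMField.complexConj F x)) = starRingEnd ℂ (ι₁ ((g⁻¹ : F ≃ₐ[ℚ] F) x)) := by
      have h1 := IsCMField.complexEmbedding_complexConj F (ι₁.comp ((g⁻¹ : F ≃ₐ[ℚ] F) : F →+* F)) x
      -- `(ι₁ ∘ g⁻¹)(c x) = conj ((ι₁ ∘ g⁻¹) x)` (definitionally the claim)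
      exact h1
    exact key
  rw [hconj]
  exact CMTypeOps.mem_iff_conjugate_notMem Φ' _

/-! ### §2 The generic sheet twist -/

set_option maxHeartbeats 400000 in
/-- **THE GENERIC SHEET TWIST OF `γ` (junction leg `hgen` of `stub_TWIST`, UNFOLDED)**: for `F ∕ ℚ` Galois CM, `ι₁`, any CM type `Φ′` (`E♯ := Aux.reflexField F Φ′ ι₁`),
a slice field `Fᵢ ∕ F` with `τE ∣ ι₁`, a level `N ≠ 0` and `γ ∈ Gal(Fᵢ∕F)`: there are an integral ideal `𝔞`, `n ∈ ℕ`, a lift `γ′ ∈ Aut(ℂ)` of `γ` through `τE`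
fixing `ι₁F`, and an `E♯`-idèle `sE ↔ γ′` (★ `IsArtinCorrespondent`, exact) such that `il(g_{Φ′}(sE)) = 𝔞⁻¹`, `g_{Φ′}(sE) ≡ 1 mod (N)` at the primes of `(N)`
(`|·|_v = 1 ∧ |· − 1|_v ≤ exp(−n_v(N))`), and (a) `(n) = 𝔞·c•𝔞`, (b) `𝔞 + (N) = (1)`, (c) `𝔞 ≠ 0`, (d) `𝔞 + c•𝔞 = (1)` — `𝔞` the `Φ*`-type product of a totally split
degree-one prime `𝔮 ∤ (N)`, `n = N𝔮`. [cite: Shimura1998, §18.6 proof pp. 127–129; §13.1 Thm. 1 (1), (7)] [cite: MilneCM2006, Ch. I §1 Prop. 1.26 (11)]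
[cite: Milne2005ShimuraVarieties, (59) p. 107; Def. 12.8 (62) p. 114] -/
theorem exists_sheetTwist_generic [IsGalois ℚ F] (ι₁ : F →+* ℂ) (Φ' : CMType F)
    {Fi : Type} [Field Fi] [NumberField Fi] [Algebra F Fi] (τE : Fi →+* ℂ) (hτE : τE.comp (algebraMap F Fi) = ι₁)
    {N : ℕ} (hN : N ≠ 0) (γ : Fi ≃ₐ[F] Fi) :
    haveI : NumberField ↥(reflexField F Φ' ι₁) := numberField_reflexField F Φ' ι₁
    ∃ (𝔞 : Ideal (𝓞 F)) (n : ℕ) (γ' : ℂ ≃+* ℂ) (sE : (FiniteAdeleRing (𝓞 ↥(reflexField F Φ' ι₁)) ↥(reflexField F Φ' ι₁))ˣ),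
      (∀ x : Fi, γ' (τE x) = τE (γ x)) ∧ (∀ x : F, γ' (ι₁ x) = ι₁ x) ∧
      IsArtinCorrespondent ↥(reflexField F Φ' ι₁) (algebraMap ↥(reflexField F Φ' ι₁) ℂ) sE γ' ∧
      toFractionalIdeal (𝓞 F) F (reflexNormFiniteIdele F Φ' (reflexField F Φ' ι₁) sE) = ((𝔞 : FractionalIdeal (𝓞 F)⁰ F))⁻¹ ∧
      (∀ v : HeightOneSpectrum (𝓞 F), Ideal.span {((N : ℕ) : 𝓞 F)} ≤ v.asIdeal →
        Valued.v ((reflexNormFiniteIdele F Φ' (reflexField F Φ' ι₁) sE : FiniteAdeleRing (𝓞 F) F) v) = 1 ∧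
        Valued.v ((reflexNormFiniteIdele F Φ' (reflexField F Φ' ι₁) sE : FiniteAdeleRing (𝓞 F) F) v - 1) ≤
          exp (-(modulusExp (Ideal.span {((N : ℕ) : 𝓞 F)}) v : ℤ))) ∧
      Ideal.span {((n : ℕ) : 𝓞 F)} = 𝔞 * (IsCMField.complexConj F) • 𝔞 ∧
      𝔞 ⊔ Ideal.span {((N : ℕ) : 𝓞 F)} = ⊤ ∧ 𝔞 ≠ ⊥ ∧ 𝔞 ⊔ (IsCMField.complexConj F) • 𝔞 = ⊤ := by
  classical
  haveI : NumberField ↥(reflexField F Φ' ι₁) := numberField_reflexField F Φ' ι₁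
  letI : Algebra F ↥(reflexField F Φ' ι₁) := (toReflexField F Φ' ι₁).toAlgebra
  -- (1) lift `γ` to `γ′ ∈ Aut(ℂ)` through `τE`; it fixes `ι₁F`
  have hℵ : ℵ₀ < #ℂ := by rw [Cardinal.mk_complex]; exact Cardinal.aleph0_lt_continuum
  have hFi : #Fi ≤ ℵ₀ := by
    haveI : Countable Fi := Countable.of_equiv _ (Module.finBasis ℚ Fi).equivFun.toEquiv.symm
    exact Cardinal.mk_le_aleph0
  obtain ⟨γ', hγ'⟩ := Literature.FieldTheory.AlgClosed.exists_ringEquiv_apply_eq hℵ hFi τE (τE.comp (γ : Fi →+* Fi))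
  have hlift : ∀ x : Fi, γ' (τE x) = τE (γ x) := fun x => hγ' x
  have hfix : ∀ x : F, γ' (ι₁ x) = ι₁ x := fun x => by
    rw [← hτE, RingHom.comp_apply, hlift]
    change τE ((γ : Fi →ₐ[F] Fi) (algebraMap F Fi x)) = _
    rw [AlgHom.commutes]
  have hfix' : ∀ x : F, γ'.symm (ι₁ x) = ι₁ x := fun x => by
    rw [RingEquiv.symm_apply_eq, hfix]
  -- (2) an `F`-idèle `s ↔ γ′⁻¹` whose ideal is a totally split prime `𝔮 ∤ (N)`, `≡ 1 mod (N)`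
  have hNF : (Ideal.span {((N : ℕ) : 𝓞 F)} : Ideal (𝓞 F)) ≠ ⊥ := by
    rw [Ne, Ideal.span_singleton_eq_bot]; exact_mod_cast hN
  obtain ⟨s, q, hs, -, hqN, hq, hinj, hsid, hscong⟩ :=
    exists_isArtinCorrespondent_splitPrime_congr ι₁ γ'.symm hfix' hNF (∅ : Set (HeightOneSpectrum (𝓞 F))) Set.finite_empty
  -- (3) transport to `E♯` by the conorm, invert
  have hsm : HasSmallReflex F Φ' ι₁ := hasSmallReflex_of_isGalois F Φ' ι₁
  set u : (FiniteAdeleRing (𝓞 ↥(reflexField F Φ' ι₁)) ↥(reflexField F Φ' ι₁))ˣ := finiteIdeleConorm F ↥(reflexField F Φ' ι₁) s with hu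
  have hu_corr : IsArtinCorrespondent ↥(reflexField F Φ' ι₁) (algebraMap ↥(reflexField F Φ' ι₁) ℂ) u γ'.symm :=
    isArtinCorrespondent_finiteIdeleConorm_of_hasSmallReflex F Φ' ι₁ hsm γ'.symm s hs
  have hsE : IsArtinCorrespondent ↥(reflexField F Φ' ι₁) (algebraMap ↥(reflexField F Φ' ι₁) ℂ) u⁻¹ γ' := by
    simpa only [RingEquiv.symm_symm] using hu_corr.symm' (algebraMap ↥(reflexField F Φ' ι₁) ℂ)
  -- (4) the ideal of `g(u)`: the `Φ*`-type product of `𝔮`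
  set Φs : Finset (F ≃ₐ[ℚ] F) :=
    Finset.univ.filter (fun g : F ≃ₐ[ℚ] F => (RingHom.id F).comp ((g⁻¹ : F ≃ₐ[ℚ] F) : F →+* F) ∈ valuedIn ι₁ Φ'.1) with hΦs
  set 𝔞 : Ideal (𝓞 F) := ∏ g ∈ Φs, g • q.asIdeal with h𝔞
  have hgu : toFractionalIdeal (𝓞 F) F (reflexNormFiniteIdele F Φ' (reflexField F Φ' ι₁) u) = ((𝔞 : FractionalIdeal (𝓞 F)⁰ F)) := by
    rw [hu, toFractionalIdeal_reflexNormFiniteIdele_finiteIdeleConorm_of_eq_coeIdeal F Φ' ι₁ s q.asIdeal q.ne_bot hsid,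
      idealReflexTypeNorm_eq_prod_filter_smul (valuedIn ι₁ Φ'.1) (RingHom.id F) (RingHom.id F) q.asIdeal]
  have hz : toFractionalIdeal (𝓞 F) F (reflexNormFiniteIdele F Φ' (reflexField F Φ' ι₁) u⁻¹) = ((𝔞 : FractionalIdeal (𝓞 F)⁰ F))⁻¹ := by
    rw [map_inv, ← IdeleIdeal.coe_toIdealUnits, map_inv, Units.val_inv_eq_inv_val, IdeleIdeal.coe_toIdealUnits, hgu]
  -- (5) the congruence of `z = g(u)⁻¹` at the primes of `(N)`: from `s` through `con` and `g`
  have hucong := finiteIdeleConorm_congr_at_primes_natCast F ↥(reflexField F Φ' ι₁) hN hscong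
  have hzcong := reflexNormFiniteIdele_congr_at_primes_natCast_inv F Φ' (reflexField F Φ' ι₁) hN hucong
  -- (6) rows (a)(b)(c)(d)
  have hΦcm : ∀ g : F ≃ₐ[ℚ] F, g ∈ Φs ↔ ((IsCMField.complexConj F).restrictScalars ℚ) * g ∉ Φs :=
    fun g => mem_filter_iff_conj_mul_not_mem ι₁ Φ' g
  obtain ⟨ha, hb, hc, hd⟩ := splitPrime_typeProd_twistRows Φs hΦcm hqN hinj
  exact ⟨𝔞, Ideal.absNorm q.asIdeal, γ', u⁻¹, hlift, hfix, hsE, hz, hzcong, ha, hb, hc, hd⟩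

end Summit.HodgeConjecture.HodgeConjecture.Theorems.F0P6aSheetTwistGeneric

end
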